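import Summits.AtomisticToContinuum.HydrodynamicLimit.Theorems.CollisionIsometryCLTMacroClosureStubClausiusFor
import HarnessLib

/-!
# Stub `stub_clausius_twoScale` of the line `IdeatorTwoGen1Sketch` (crux `MacroClosure`, stmt-14870):
# TWO-SCALE kernel-parametrised Clausius in mean on the good event, conditionally on Ruelle convexity

Proof file (`--supports stmt-AtomisticToContinuum-14870`) for the registered stub `Barycentric.stub_clausius_twoScale`:
the landed `stub_clausius_for` (`…StubClausiusFor.lean`) over `Clausius.core_bound₂`, the TWO-BAND version of the
fixed-`N`, fixed-`s` bound `Clausius.core_bound` (`…StubClausiusCoreB.lean`) in which the tilt is restricted to the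
two-band event `B ∩ B₂` (all `φ`-blocks AND all `φ₂`-blocks in their bands; the deterministic core
`Clausius.core_pointwise` only uses the `φ`-band), the two-scale MGF being consumed at `(u_c, θ_c) = (0, 1)`.
-/

noncomputable section

open MeasureTheory Filter Set Topology InformationTheory
open scoped ENNReal ContDiff

namespace Summit.AtomisticToContinuum.HydrodynamicLimit.Theorems.MacroClosureLine

open Literature.MathematicalPhysics.KineticTheory Literature.Analysis.FluidPDE
open Literature.Analysis.FunctionSpaces
open Summit.AtomisticToContinuum.HydrodynamicLimit.Theses

namespace Barycentric

namespace Clausius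

variable {N : ℕ}

/-- **The fixed-`N`, fixed-`s` inequality in mean on the good event, two-band version.** As
`Clausius.core_bound`, with a second continuous kernel `φ₂` and floor `c₂`: the block MGF is assumed with the
tilt restricted to the two-band event `{∀ x, c₁ ≤ ρ̄_φ ≤ σ⁻³} ∩ {∀ x, c₂ ≤ ρ̄_{φ₂} ≤ σ⁻³}`, and `Φ_s(G)` is
assumed to lie in both bands. [folklore] -/
theorem core_bound₂ {σ : ℝ} (hσ : 0 < σ) (hσ2 : σ ≤ 1 / 2) {a₀ θ₀ : T3 → ℝ} {u₀ : T3 → V3}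
    (ha : Continuous a₀) (hθ : Continuous θ₀) (hu : Continuous u₀) (ha0 : ∀ x, 0 < a₀ x)
    (hθ0 : ∀ x, 0 < θ₀ x) (uc : V3) {θc : ℝ} (hθc : 0 < θc) (Φ : Flow σ N) {c₁ : ℝ} (hc₁ : 0 < c₁)
    (hc₁σ : c₁ * σ ^ 3 ≤ 1) (hfex : ContinuousOn hsExcessFreeEnergy (Icc (c₁ * σ ^ 3) 1)) {φ : T3 → ℝ}
    (hφc : Continuous φ) (hφ0 : ∀ y, 0 ≤ φ y) (hφ1 : ∫ y, φ y = 1) {Φb : ℝ} (hφb : ∀ y, φ y ≤ Φb)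
    (hN : Φb < ((N + 1 : ℕ) : ℝ) * c₁) {φ₂ : T3 → ℝ} (hφ₂c : Continuous φ₂) {c₂ γ' ε : ℝ} (hγ' : 0 < γ')
    (hMGF : ∫⁻ z, ENNReal.ofReal (Real.exp (γ' * ((N : ℝ) + 1) *
        {z : Config (N + 1) (Fin 3) T3 | (∀ x, c₁ ≤ bρ φ z x ∧ bρ φ z x * σ ^ 3 ≤ 1) ∧
            (∀ x, c₂ ≤ bρ φ₂ z x ∧ bρ φ₂ z x * σ ^ 3 ≤ 1)}.indicator
          (fun z => ∫ x, max 0 (relEnt σ (bU φ z x) (stateOf 1 uc θc))) z))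
        ∂(localGibbsLaw σ (fun _ => 1) (fun _ => uc) (fun _ => θc) N Φ) ≤
      ENNReal.ofReal (Real.exp (ε * ((N : ℝ) + 1))))
    {G : Set (Config (N + 1) (Fin 3) T3)} (hGm : MeasurableSet G) (hGgood : G ⊆ Φ.good) (s : ℝ)
    (hGband : ∀ z ∈ G, ∀ x, c₁ ≤ bρ φ (Φ.flow s z) x ∧ bρ φ (Φ.flow s z) x * σ ^ 3 ≤ 1)
    (hGband₂ : ∀ z ∈ G, ∀ x, c₂ ≤ bρ φ₂ (Φ.flow s z) x ∧ bρ φ₂ (Φ.flow s z) x * σ ^ 3 ≤ 1) :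
    Integrable (fun z => G.indicator (fun z => ∫ x, hsEntropy σ (bU φ (Φ.flow s z) x)) z)
        (localGibbsLaw σ a₀ u₀ θ₀ N Φ) ∧
    ∫ z, G.indicator (fun z => ∫ x, hsEntropy σ (bU φ (Φ.flow s z) x)) z ∂(localGibbsLaw σ a₀ u₀ θ₀ N Φ) ≤
      (γ' * ((N : ℝ) + 1))⁻¹ * ((klDiv (localGibbsLaw σ a₀ u₀ θ₀ N Φ)
          (localGibbsLaw σ (fun _ => 1) (fun _ => uc) (fun _ => θc) N Φ)).toReal + ε * ((N : ℝ) + 1)) +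
      ∫ z, G.indicator (fun z => hsEntropy σ (stateOf 1 uc θc) +
          fderiv ℝ (hsEntropy σ) (stateOf 1 uc θc) ((((1 : ℝ), empiricalMomentumField z (fun _ => (1 : ℝ)),
            empiricalEnergyField z (fun _ => (1 : ℝ))) : State) - stateOf 1 uc θc)) z
        ∂(localGibbsLaw σ a₀ u₀ θ₀ N Φ) := by
  -- adapted from `Clausius.core_bound` (`…StubClausiusCoreB.lean`): `B` is now the two-band event
  set P : Measure (Config (N + 1) (Fin 3) T3) := localGibbsLaw σ a₀ u₀ θ₀ N Φ with hP
  set Gm : Measure (Config (N + 1) (Fin 3) T3) :=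
    localGibbsLaw σ (fun _ => 1) (fun _ => uc) (fun _ => θc) N Φ with hGmdef
  set T : Config (N + 1) (Fin 3) T3 → Config (N + 1) (Fin 3) T3 := Φ.flow s with hT
  set B : Set (Config (N + 1) (Fin 3) T3) := {w | (∀ x, c₁ ≤ bρ φ w x ∧ bρ φ w x * σ ^ 3 ≤ 1) ∧
    (∀ x, c₂ ≤ bρ φ₂ w x ∧ bρ φ₂ w x * σ ^ 3 ≤ 1)} with hB
  set Uc : State := stateOf 1 uc θc with hUc
  set Λ : State →L[ℝ] ℝ := fderiv ℝ (hsEntropy σ) Uc with hΛ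
  set Tot : Config (N + 1) (Fin 3) T3 → State := fun z =>
    (((1 : ℝ), empiricalMomentumField z (fun _ => (1 : ℝ)), empiricalEnergyField z (fun _ => (1 : ℝ))) : State)
    with hTot
  set S : Config (N + 1) (Fin 3) T3 → ℝ := fun z => hsEntropy σ Uc + Λ (Tot z - Uc) with hS
  set e : Config (N + 1) (Fin 3) T3 → ℝ := fun z => empiricalEnergyField z (fun _ => (1 : ℝ)) with he
  set I : Config (N + 1) (Fin 3) T3 → ℝ := fun z => ∫ x, hsEntropy σ (bU φ (T z) x) with hI
  set hplus : Config (N + 1) (Fin 3) T3 → ℝ := fun w => ∫ x, max 0 (relEnt σ (bU φ w x) Uc) with hhplus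
  set cN : ℝ := γ' * ((N : ℝ) + 1) with hcN
  have hcN0 : 0 < cN := mul_pos hγ' (by positivity)
  haveI hPprob : IsProbabilityMeasure P := isProbabilityMeasure_localGibbsLaw ha hθ hu ha0 hθ0 hσ2 N Φ
  haveI hGprob : IsProbabilityMeasure Gm :=
    isProbabilityMeasure_localGibbsLaw continuous_const continuous_const continuous_const
      (fun _ => one_pos) (fun _ => hθc) hσ2 N Φ
  have hTm : Measurable T := Φ.measurable_flow s
  -- clamped (measurable) versions of the block functionals
  set clamp : State → State := fun U => ((max c₁ (min U.1 (σ ^ 3)⁻¹), U.2) : State) with hclamp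
  set ηc : State → ℝ := fun U => hsEntropy σ (clamp U) with hηc
  set hc : State → ℝ := fun U => max 0 (ηc U - hsEntropy σ Uc - Λ (U - Uc)) with hhc
  have hηcm : Measurable ηc := measurable_hsEntropy_clamp hσ hc₁σ hfex
  have hhcm : Measurable hc :=
    measurable_const.max ((hηcm.sub measurable_const).sub (Λ.measurable.comp (measurable_id.sub measurable_const)))
  have hband_eq : ∀ w ∈ B, ∀ x, clamp (bU φ w x) = bU φ w x := fun w hw x =>
    clamp_eq_of_band hσ (hw.1 x).1 (hw.1 x).2
  -- measurability of the clamped parametric integrals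
  have hIc_m : Measurable fun w : Config (N + 1) (Fin 3) T3 => ∫ x, ηc (bU φ w x) := by
    have hj : Measurable fun p : Config (N + 1) (Fin 3) T3 × T3 => ηc (bU φ p.1 p.2) :=
      hηcm.comp (measurable_bU_prod hφc)
    exact (hj.stronglyMeasurable.integral_prod_right' (ν := volume)).measurable
  have hplusc_m : Measurable fun w : Config (N + 1) (Fin 3) T3 => ∫ x, hc (bU φ w x) := by
    have hj : Measurable fun p : Config (N + 1) (Fin 3) T3 × T3 => hc (bU φ p.1 p.2) :=
      hhcm.comp (measurable_bU_prod hφc)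
    exact (hj.stronglyMeasurable.integral_prod_right' (ν := volume)).measurable
  -- the tilt, in measurable form, and its identification with the tilt of `hMGF`
  set F : Config (N + 1) (Fin 3) T3 → ℝ := fun w => cN * B.indicator (fun w => ∫ x, hc (bU φ w x)) w with hF
  have hBm : MeasurableSet B := by
    rw [hB, setOf_and]
    exact (measurableSet_band hφc).inter (measurableSet_band hφ₂c)
  have hFm : Measurable F := measurable_const.mul (hplusc_m.indicator hBm)
  have hF0 : ∀ w, 0 ≤ F w := fun w => mul_nonneg hcN0.le
    (Set.indicator_nonneg (fun w _ => integral_nonneg fun x => le_max_left _ _) w)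
  have hplus_eq : ∀ w ∈ B, (∫ x, hc (bU φ w x)) = hplus w := by
    intro w hw
    refine integral_congr_ae (Eventually.of_forall fun x => ?_)
    simp only [hhc, hηc, hband_eq w hw x]
    rfl
  have hF_eq : ∀ w, F w = cN * B.indicator hplus w := by
    intro w
    by_cases hw : w ∈ B
    · simp only [hF, indicator_of_mem hw, hplus_eq w hw]
    · simp only [hF, indicator_of_notMem hw]
  -- Step 1: the entropy inequality with the invariant homogeneous law
  have hKL : klDiv P Gm ≠ ⊤ :=
    klDiv_localGibbsLaw_ne_top hσ2 Φ ha hθ hu continuous_const continuous_const continuous_const ha0 hθ0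
      (fun _ => one_pos) (fun _ => hθc)
  have hMGF' : ∫⁻ z, ENNReal.ofReal (Real.exp (F (T z))) ∂Gm ≤ ENNReal.ofReal (Real.exp (ε * ((N : ℝ) + 1))) := by
    have hmeas : Measurable fun w => ENNReal.ofReal (Real.exp (F w)) := hFm.exp.ennreal_ofReal
    calc ∫⁻ z, ENNReal.ofReal (Real.exp (F (T z))) ∂Gm
        = ∫⁻ w, ENNReal.ofReal (Real.exp (F w)) ∂(Gm.map T) := (lintegral_map hmeas hTm).symm
      _ = ∫⁻ w, ENNReal.ofReal (Real.exp (F w)) ∂Gm := by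
          rw [hGmdef, hT, map_flow_localGibbsLaw_const σ 1 θc uc N Φ s]
      _ = ∫⁻ w, ENNReal.ofReal (Real.exp (cN * B.indicator hplus w)) ∂Gm :=
          lintegral_congr fun w => by rw [hF_eq w]
      _ ≤ ENNReal.ofReal (Real.exp (ε * ((N : ℝ) + 1))) := hMGF
  obtain ⟨hFTint', hFTle'⟩ :=
    integral_le_toReal_klDiv_add_of_nonneg (μ := P) (ν := Gm) hKL (hFm.comp hTm) (fun z => hF0 (T z)) hMGF'
  have hFTint : Integrable (fun z => F (T z)) P := hFTint'
  have hFTle : ∫ z, F (T z) ∂P ≤ (klDiv P Gm).toReal + ε * ((N : ℝ) + 1) := hFTle'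
  -- Step 2: almost sure pointwise bounds from the deterministic core
  have hae := ae_pairwise_vel_ne (N := N) a₀ u₀ θ₀ Φ s
  have hpt : ∀ᵐ z ∂P, z ∈ G →
      -(e z) - 1 ≤ I z ∧ I z ≤ cN⁻¹ * F (T z) + S z ∧ I z = ∫ x, ηc (bU φ (T z) x) := by
    filter_upwards [hae] with z hz hzG
    have hzB1 : ∀ x, c₁ ≤ bρ φ (T z) x ∧ bρ φ (T z) x * σ ^ 3 ≤ 1 := hGband z hzG
    have hzB : T z ∈ B := ⟨hzB1, hGband₂ z hzG⟩
    obtain ⟨-, hfloor, htel⟩ := core_pointwise hσ hc₁ hfex hφc hφ0 hφ1 hφb hN Uc (T z) hzB1 hz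
    obtain ⟨hpcons, hecons⟩ := totals_flow Φ (hGgood hzG) s
    refine ⟨?_, ?_, ?_⟩
    · simpa only [he, hT, hecons] using hfloor
    · have hFT : F (T z) = cN * hplus (T z) := by rw [hF_eq, indicator_of_mem hzB]
      have h1 : cN⁻¹ * F (T z) = hplus (T z) := by
        rw [hFT, ← mul_assoc, inv_mul_cancel₀ hcN0.ne', one_mul]
      rw [h1]
      simpa only [hI, hS, hTot, hhplus, hT, hpcons, hecons, add_assoc] using htel
    · simp only [hI, hηc, hband_eq (T z) hzB]
  -- Step 3: integrability of the good-event functional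
  have heInt : Integrable e P := by
    have hK := JaynesSqueezeSqueeze.integrable_kineticPair_localGibbsLaw hσ2 ha hθ hu ha0 hθ0 N Φ
    have : e = fun z => 2⁻¹ * ∫ y, ‖y.2‖ ^ 2 ∂(empiricalMeasure z) :=
      funext fun z => empiricalEnergyField_one_eq_half_kineticPair z
    rw [this]
    exact hK.const_mul _
  have hSm : Measurable S := by
    have : Continuous S := continuous_const.add (Λ.continuous.comp (continuous_totals.sub continuous_const))
    exact this.measurable
  have hSbound : ∀ z, |S z| ≤ |hsEntropy σ Uc| + ‖Λ‖ * (3 / 2 + ‖Uc‖) + 2 * ‖Λ‖ * e z := fun z =>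
    abs_goodFunctional_le σ Uc z
  have hSint : Integrable S P := by
    refine Integrable.mono' ((integrable_const (|hsEntropy σ Uc| + ‖Λ‖ * (3 / 2 + ‖Uc‖))).add
      (heInt.const_mul (2 * ‖Λ‖))) hSm.aestronglyMeasurable (ae_of_all _ fun z => ?_)
    rw [Real.norm_eq_abs]
    simpa only [Pi.add_apply] using hSbound z
  have hGIm : AEStronglyMeasurable (fun z => G.indicator I z) P := by
    have hm : Measurable fun z => G.indicator (fun z => ∫ x, ηc (bU φ (T z) x)) z :=
      (hIc_m.comp hTm).indicator hGm
    refine (hm.aestronglyMeasurable).congr ?_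
    filter_upwards [hpt] with z hz
    by_cases hzG : z ∈ G
    · simp only [indicator_of_mem hzG, (hz hzG).2.2]
    · simp only [indicator_of_notMem hzG]
  have hdom : ∀ᵐ z ∂P, ‖G.indicator I z‖ ≤ cN⁻¹ * F (T z) + |S z| + (e z + 1) := by
    filter_upwards [hpt] with z hz
    by_cases hzG : z ∈ G
    · obtain ⟨hlo, hhi, -⟩ := hz hzG
      rw [indicator_of_mem hzG, Real.norm_eq_abs, abs_le]
      have hF0' : 0 ≤ cN⁻¹ * F (T z) := mul_nonneg (inv_nonneg.2 hcN0.le) (hF0 _)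
      have he0 : 0 ≤ e z := empiricalEnergyField_one_nonneg z
      constructor
      · linarith [hlo, abs_nonneg (S z), hF0']
      · linarith [hhi, le_abs_self (S z)]
    · rw [indicator_of_notMem hzG, norm_zero]
      have hF0' : 0 ≤ cN⁻¹ * F (T z) := mul_nonneg (inv_nonneg.2 hcN0.le) (hF0 _)
      have := empiricalEnergyField_one_nonneg z
      positivity
  have hGIint : Integrable (fun z => G.indicator I z) P :=
    Integrable.mono' (((hFTint.const_mul _).add hSint.abs).add (heInt.add (integrable_const _))) hGIm hdom
  refine ⟨hGIint, ?_⟩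
  -- Step 4: the bound
  have hGSint : Integrable (fun z => G.indicator S z) P := hSint.indicator hGm
  have hle : ∀ᵐ z ∂P, G.indicator I z ≤ cN⁻¹ * F (T z) + G.indicator S z := by
    filter_upwards [hpt] with z hz
    by_cases hzG : z ∈ G
    · rw [indicator_of_mem hzG, indicator_of_mem hzG]
      exact (hz hzG).2.1
    · rw [indicator_of_notMem hzG, indicator_of_notMem hzG, add_zero]
      exact mul_nonneg (inv_nonneg.2 hcN0.le) (hF0 _)
  calc ∫ z, G.indicator I z ∂P ≤ ∫ z, (cN⁻¹ * F (T z) + G.indicator S z) ∂P :=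
        integral_mono_ae hGIint ((hFTint.const_mul _).add hGSint) hle
    _ = cN⁻¹ * ∫ z, F (T z) ∂P + ∫ z, G.indicator S z ∂P := by
        rw [integral_add (hFTint.const_mul _) hGSint, integral_const_mul]
    _ ≤ cN⁻¹ * ((klDiv P Gm).toReal + ε * ((N : ℝ) + 1)) + ∫ z, G.indicator S z ∂P := by
        have := mul_le_mul_of_nonneg_left hFTle (inv_nonneg.2 hcN0.le)
        linarith

end Clausius

open Clausius in
/-- **`stub_clausius_twoScale` (registered stub):** for ONE pair of kernel families `(φ, φ₂)`, Clausius in mean on good events carrying BOTH a-priori bands, uniformly in time, from the two-scale block MGF of the pair and the initial entropy value, GIVEN Ruelle convexity (used only for the continuity of `f_ex` on the band packings). [folklore] -/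
theorem stub_clausius_twoScale : StiffCollisionalRelaxation.HsFreeEnergyConvex →
    ∀ (γ C : ℝ) (φ : ℕ → T3 → ℝ) (γ₂ C₂ : ℝ) (φ₂ : ℕ → T3 → ℝ),
    (∃ σ₀ : ℝ, 0 < σ₀ ∧ ∀ σ : ℝ, 0 < σ → σ < σ₀ → ∀ (uc : V3) (θc : ℝ), 0 < θc →
      ∀ c₁ : ℝ, 0 < c₁ → ∀ c₂ : ℝ, 0 < c₂ → ∀ γ' : ℝ, 0 < γ' → γ' < 1 → ∀ ε : ℝ, 0 < ε →
      ∀ᶠ N : ℕ in atTop, ∀ Φ : Flow σ N,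
        ∫⁻ z, ENNReal.ofReal (Real.exp (γ' * ((N : ℝ) + 1) *
            {z : Config (N + 1) (Fin 3) T3 |
                (∀ x, c₁ ≤ bρ (φ N) z x ∧ bρ (φ N) z x * σ ^ 3 ≤ 1) ∧
                (∀ x, c₂ ≤ bρ (φ₂ N) z x ∧ bρ (φ₂ N) z x * σ ^ 3 ≤ 1)}.indicator
              (fun z => ∫ x, max 0 (relEnt σ (bU (φ N) z x) (stateOf 1 uc θc))) z))
          ∂(localGibbsLaw σ (fun _ => 1) (fun _ => uc) (fun _ => θc) N Φ) ≤
        ENNReal.ofReal (Real.exp (ε * ((N : ℝ) + 1)))) →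
    InitialEntropyValue →
    ∀ (a₀ θ₀ : T3 → ℝ) (u₀ : T3 → V3), Continuous a₀ → Continuous θ₀ → Continuous u₀ →
    (∀ x, 0 < a₀ x) → (∀ x, 0 < θ₀ x) →
    ∃ σ₀ : ℝ, 0 < σ₀ ∧ ∀ σ : ℝ, 0 < σ → σ < σ₀ →
      ∀ (T : ℝ) (ρ θ : ℝ → T3 → ℝ) (u : ℝ → T3 → V3), IsHardSphereEulerSolution σ T ρ u θ →
        ∀ Φ : (N : ℕ) → Flow σ N,
          TendstoHydroFieldsAt (fun N => localGibbsLaw σ a₀ u₀ θ₀ N (Φ N)) Φ ρ u θ 0 →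
          0 < γ → γ ≤ 1 / 15 → AdmissibleKernel γ C φ → 0 < γ₂ → γ₂ ≤ 1 / 15 → AdmissibleKernel γ₂ C₂ φ₂ →
          ∀ (c₁ c₂ t₁ : ℝ), 0 < c₁ → 0 < c₂ → 0 < t₁ → t₁ < T →
          ∀ G : (N : ℕ) → Set (Config (N + 1) (Fin 3) T3), (∀ N, MeasurableSet (G N)) →
            (∀ N, G N ⊆ (Φ N).good) →
            (∀ N, ∀ z ∈ G N, ∀ s ∈ Icc 0 t₁, ∀ x,
                c₁ ≤ bρ (φ N) ((Φ N).flow s z) x ∧ bρ (φ N) ((Φ N).flow s z) x * σ ^ 3 ≤ 1) →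
            (∀ N, ∀ z ∈ G N, ∀ s ∈ Icc 0 t₁, ∀ x,
                c₂ ≤ bρ (φ₂ N) ((Φ N).flow s z) x ∧ bρ (φ₂ N) ((Φ N).flow s z) x * σ ^ 3 ≤ 1) →
            Tendsto (fun N => localGibbsLaw σ a₀ u₀ θ₀ N (Φ N) (G N)ᶜ) atTop (𝓝 0) →
            ∀ δ : ℝ, 0 < δ → ∀ᶠ N : ℕ in atTop, ∀ s ∈ Icc 0 t₁,
              Integrable (fun z => (G N).indicator
                  (fun z => ∫ x, hsEntropy σ (bU (φ N) ((Φ N).flow s z) x)) z)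
                (localGibbsLaw σ a₀ u₀ θ₀ N (Φ N)) ∧
              ∫ z, (G N).indicator (fun z => ∫ x, hsEntropy σ (bU (φ N) ((Φ N).flow s z) x)) z
                  ∂(localGibbsLaw σ a₀ u₀ θ₀ N (Φ N)) ≤
                (∫ x, hsEntropy σ (stateOf (ρ 0 x) (u 0 x) (θ 0 x))) + δ := by
  -- adapted from `Barycentric.stub_clausius_for` (`…StubClausiusFor.lean`)
  intro hH γ C φ γ₂ C₂ φ₂ hM hI a₀ θ₀ u₀ ha hθ hu ha0 hθ0
  obtain ⟨σM, hσM, HM⟩ := hM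
  obtain ⟨σI, hσI, HI⟩ := hI a₀ θ₀ u₀ ha hθ hu ha0 hθ0
  obtain ⟨σ₂, hσ₂, hσ₂2, H2⟩ := identify a₀ θ₀ u₀ ha hθ hu ha0 hθ0
  refine ⟨min σM (min σI σ₂), lt_min hσM (lt_min hσI hσ₂), fun σ hσ hσlt => ?_⟩
  have hσM' : σ < σM := lt_of_lt_of_le hσlt (min_le_left _ _)
  have hσI' : σ < σI := lt_of_lt_of_le hσlt ((min_le_right _ _).trans (min_le_left _ _))
  have hσ₂' : σ < σ₂ := lt_of_lt_of_le hσlt ((min_le_right _ _).trans (min_le_right _ _))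
  have hσhalf : σ ≤ 1 / 2 := (hσ₂'.trans_le hσ₂2).le
  have hσ3 : 0 < σ ^ 3 := pow_pos hσ 3
  intro T ρ θ u hE Φ hT hγ hγ15 hφA _ _ hφ₂A c₁ c₂ t₁ hc₁ hc₂ ht₁ ht₁T G hGm hGgood hGband hGband₂ hGc δ hδ
  have hT0 : 0 < T := ht₁.trans ht₁T
  have h0T : (0 : ℝ) ∈ Ico 0 T := ⟨le_rfl, hT0⟩
  have h0t : (0 : ℝ) ∈ Icc 0 t₁ := ⟨le_rfl, ht₁.le⟩
  obtain ⟨huu, hθθ, hpack, hmass, hdens⟩ := H2 σ hσ hσ₂' T ρ θ u hE hT0 Φ hT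
  have hφs : ∀ N, Torus.IsSmooth (φ N) := hφA.1
  have hφ₂s : ∀ N, Torus.IsSmooth (φ₂ N) := hφ₂A.1
  have hφ0 : ∀ N y, 0 ≤ φ N y := hφA.2.1
  have hφ1 : ∀ N, ∫ y, φ N y = 1 := hφA.2.2.1
  have hφb : ∀ (N : ℕ) y, φ N y ≤ C * ((N : ℝ) + 1) ^ (3 * γ) := hφA.2.2.2.2.1
  set P : (N : ℕ) → Measure (Config (N + 1) (Fin 3) T3) := fun N => localGibbsLaw σ a₀ u₀ θ₀ N (Φ N) with hP
  haveI hPprob : ∀ N, IsProbabilityMeasure (P N) := fun N =>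
    isProbabilityMeasure_localGibbsLaw ha hθ hu ha0 hθ0 hσhalf N (Φ N)
  -- WLOG the band is non-empty: `c₁ σ³ ≤ 1`
  by_cases hc₁σ : c₁ * σ ^ 3 ≤ 1
  swap
  · exfalso
    have hGempty : ∀ N, G N = ∅ := by
      intro N
      ext z
      simp only [mem_empty_iff_false, iff_false]
      intro hz
      obtain ⟨h1, h2⟩ := hGband N z hz 0 h0t 0
      exact hc₁σ ((mul_le_mul_of_nonneg_right h1 hσ3.le).trans h2)
    have h1 : Tendsto (fun _ : ℕ => (1 : ℝ≥0∞)) atTop (𝓝 0) := by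
      refine hGc.congr fun N => ?_
      simp only [hGempty N, compl_empty, measure_univ]
    have := tendsto_nhds_unique h1 tendsto_const_nhds
    exact zero_ne_one this
  -- data at `t = 0`
  have hρc : Continuous (ρ 0) := (hE.smooth_density.isSmooth_slice h0T).continuous
  have huc : Continuous (u 0) := (hE.smooth_velocity.isSmooth_slice h0T).continuous
  have hθc : Continuous (θ 0) := (hE.smooth_temperature.isSmooth_slice h0T).continuous
  have hρpos : ∀ x, 0 < ρ 0 x := hE.density_pos 0 h0T
  have hθpos : ∀ x, 0 < θ 0 x := hE.temperature_pos 0 h0T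
  have hfexO := continuousOn_hsExcessFreeEnergy hH
  have hfex : ContinuousOn hsExcessFreeEnergy (Icc (c₁ * σ ^ 3) 1) :=
    hfexO.mono fun r hr => ⟨(mul_pos hc₁ hσ3).trans_le hr.1, hr.2.trans_lt (by norm_num)⟩
  -- the homogeneous state, the entropy variable and the limits
  set Uc : State := stateOf 1 (0 : V3) 1 with hUc
  set H₀ : ℝ := ∫ x, relEnt σ (stateOf (ρ 0 x) (u 0 x) (θ 0 x)) Uc with hH₀
  set P₀ : V3 := ∫ x, ((fun _ : T3 => (1 : ℝ)) x * ρ 0 x) • u 0 x with hP₀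
  set E₀ : ℝ := ∫ x, (fun _ : T3 => (1 : ℝ)) x * totalEnergyDensity (ρ 0 x) (u 0 x) (θ 0 x) with hE₀
  set Sinf : ℝ := hsEntropy σ Uc + fderiv ℝ (hsEntropy σ) Uc ((((1 : ℝ), P₀, E₀) : State) - Uc) with hSinf
  -- the continuum telescope `∫ η(U_cl(0)) = H₀ + Sinf`
  have htelescope : ∫ x, hsEntropy σ (stateOf (ρ 0 x) (u 0 x) (θ 0 x)) = H₀ + Sinf := by
    have h := telescope_continuum hσ hfexO hρc huc hθc hρpos hθpos hpack hmass Uc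
    have hP₀' : (∫ x, ρ 0 x • u 0 x) = P₀ := by simp only [hP₀, one_mul]
    have hE₀' : (∫ x, totalEnergyDensity (ρ 0 x) (u 0 x) (θ 0 x)) = E₀ := by simp only [hE₀, one_mul]
    rw [h, hP₀', hE₀', hSinf, hH₀]
    ring
  -- parameters `γ'` and `ε`
  obtain ⟨hγ'half, hγ'1, hγ'gap⟩ := tilt_bounds H₀ δ hδ
  set γ' : ℝ := max (1 / 2) (1 - δ / (8 * (|H₀| + 1))) with hγ'
  have hγ'0 : 0 < γ' := lt_of_lt_of_le (by norm_num) hγ'half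
  set ε : ℝ := γ' * δ / 4 with hε
  have hε0 : 0 < ε := by positivity
  -- the homogeneous laws
  set Gm : (N : ℕ) → Measure (Config (N + 1) (Fin 3) T3) :=
    fun N => localGibbsLaw σ (fun _ => 1) (fun _ => (0 : V3)) (fun _ => 1) N (Φ N) with hGmdef
  -- (1) the two-scale block MGF, for all flows
  have hev1 := HM σ hσ hσM' (0 : V3) 1 one_pos c₁ hc₁ c₂ hc₂ γ' hγ'0 hγ'1 ε hε0
  -- (2) the initial entropy value
  have hev2 : ∀ᶠ N : ℕ in atTop, (klDiv (P N) (Gm N)).toReal / ((N : ℝ) + 1) < H₀ + δ / 8 := by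
    have h := HI σ hσ hσI' (0 : V3) 1 one_pos (ρ 0) hρc hρpos Φ hdens
    have hH₀' : (∫ x, relEnt σ (stateOf (ρ 0 x) (u₀ x) (θ₀ x)) (stateOf 1 (0 : V3) 1)) = H₀ := by
      simp only [hH₀, hUc, ← huu, ← hθθ]
    rw [hH₀'] at h
    exact (tendsto_order.1 h).2 _ (by linarith)
  -- (3) the good-event functional in mean
  have hev3 : ∀ᶠ N : ℕ in atTop, dist (∫ z, (G N).indicator (fun z => hsEntropy σ Uc +
      fderiv ℝ (hsEntropy σ) Uc ((((1 : ℝ), empiricalMomentumField z (fun _ => (1 : ℝ)),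
        empiricalEnergyField z (fun _ => (1 : ℝ))) : State) - Uc)) z ∂P N) Sinf < δ / 4 := by
    have hmom : ∀ δ' : ℝ, 0 < δ' → Tendsto (fun N => P N
        {z | δ' < ‖empiricalMomentumField z (fun _ => (1 : ℝ)) - P₀‖}) atTop (𝓝 0) := fun δ' hδ' =>
      ((hT (fun _ => (1 : ℝ)) continuous_const δ' hδ').2.1).congr fun N =>
        localGibbsLaw_setOf_flow_zero a₀ u₀ θ₀ N (Φ N)
          (fun w => δ' < ‖empiricalMomentumField w (fun _ => (1 : ℝ)) - P₀‖)
    have hen : ∀ δ' : ℝ, 0 < δ' → Tendsto (fun N => P N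
        {z | δ' < |empiricalEnergyField z (fun _ => (1 : ℝ)) - E₀|}) atTop (𝓝 0) := fun δ' hδ' =>
      ((hT (fun _ => (1 : ℝ)) continuous_const δ' hδ').2.2).congr fun N =>
        localGibbsLaw_setOf_flow_zero a₀ u₀ θ₀ N (Φ N)
          (fun w => δ' < |empiricalEnergyField w (fun _ => (1 : ℝ)) - E₀|)
    have hlim := tendsto_goodFunctional hσhalf ha hθ hu ha0 hθ0 Φ Uc P₀ E₀ hmom hen hGm hGc
    exact hlim.eventually (Metric.ball_mem_nhds _ (by positivity))
  -- (4) two particles per block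
  have hev4 := eventually_kernel_lt (C := C) (γ := γ) (by linarith) hc₁
  -- assembly
  filter_upwards [hev1, hev2, hev3, hev4] with N h1 h2 h3 h4
  intro s hs
  obtain ⟨hint, hbound⟩ := core_bound₂ hσ hσhalf ha hθ hu ha0 hθ0 (0 : V3) one_pos (Φ N) hc₁ hc₁σ hfex
    (hφs N).continuous (hφ0 N) (hφ1 N) (hφb N) h4 (hφ₂s N).continuous hγ'0 (ε := ε) (h1 (Φ N)) (hGm N)
    (hGgood N) s (fun z hz x => hGband N z hz s hs x) (fun z hz x => hGband₂ N z hz s hs x)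
  refine ⟨hint, hbound.trans ?_⟩
  -- arithmetic
  have hN0 : (0 : ℝ) < (N : ℝ) + 1 := by positivity
  set K : ℝ := (klDiv (P N) (Gm N)).toReal / ((N : ℝ) + 1) with hK
  have hK' : (klDiv (P N) (Gm N)).toReal = K * ((N : ℝ) + 1) := by rw [hK]; field_simp
  have hterm1 : (γ' * ((N : ℝ) + 1))⁻¹ * ((klDiv (P N) (Gm N)).toReal + ε * ((N : ℝ) + 1)) =
      γ'⁻¹ * K + δ / 4 := by
    rw [hK', hε]; field_simp
  have hinvγ : γ'⁻¹ ≤ 2 := by rw [inv_le_comm₀ hγ'0 two_pos]; linarith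
  have hinvγ1 : 0 ≤ γ'⁻¹ - 1 := by rw [sub_nonneg, one_le_inv₀ hγ'0]; exact hγ'1.le
  have hterm2 : γ'⁻¹ * K ≤ H₀ + δ / 4 + δ / 4 := by
    have hK8 : K < H₀ + δ / 8 := h2
    have h1' : γ'⁻¹ * K ≤ γ'⁻¹ * (H₀ + δ / 8) := mul_le_mul_of_nonneg_left hK8.le (inv_nonneg.2 hγ'0.le)
    have h2' : γ'⁻¹ * H₀ ≤ H₀ + δ / 4 := by
      have e1 : γ'⁻¹ * H₀ = H₀ + H₀ * (γ'⁻¹ - 1) := by ring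
      rw [e1]
      have : H₀ * (γ'⁻¹ - 1) ≤ |H₀| * (γ'⁻¹ - 1) := mul_le_mul_of_nonneg_right (le_abs_self _) hinvγ1
      linarith [hγ'gap]
    have h3' : γ'⁻¹ * (δ / 8) ≤ δ / 4 := by nlinarith [hinvγ, hδ]
    calc γ'⁻¹ * K ≤ γ'⁻¹ * (H₀ + δ / 8) := h1'
      _ = γ'⁻¹ * H₀ + γ'⁻¹ * (δ / 8) := by ring
      _ ≤ H₀ + δ / 4 + δ / 4 := by linarith
  have hterm3 : ∫ z, (G N).indicator (fun z => hsEntropy σ Uc +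
      fderiv ℝ (hsEntropy σ) Uc ((((1 : ℝ), empiricalMomentumField z (fun _ => (1 : ℝ)),
        empiricalEnergyField z (fun _ => (1 : ℝ))) : State) - Uc)) z ∂P N ≤ Sinf + δ / 4 := by
    have := h3; rw [Real.dist_eq, abs_lt] at this; linarith [this.2]
  rw [htelescope]
  calc (γ' * ((N : ℝ) + 1))⁻¹ * ((klDiv (P N) (Gm N)).toReal + ε * ((N : ℝ) + 1)) +
        ∫ z, (G N).indicator (fun z => hsEntropy σ Uc +
          fderiv ℝ (hsEntropy σ) Uc ((((1 : ℝ), empiricalMomentumField z (fun _ => (1 : ℝ)),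
            empiricalEnergyField z (fun _ => (1 : ℝ))) : State) - Uc)) z ∂P N
      = γ'⁻¹ * K + δ / 4 + ∫ z, (G N).indicator (fun z => hsEntropy σ Uc +
          fderiv ℝ (hsEntropy σ) Uc ((((1 : ℝ), empiricalMomentumField z (fun _ => (1 : ℝ)),
            empiricalEnergyField z (fun _ => (1 : ℝ))) : State) - Uc)) z ∂P N := by rw [hterm1]
    _ ≤ H₀ + δ / 4 + δ / 4 + δ / 4 + (Sinf + δ / 4) := by linarith
    _ = H₀ + Sinf + δ := by ring

end Barycentric

end Summit.AtomisticToContinuum.HydrodynamicLimit.Theorems.MacroClosureLine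

end
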